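import Summits.BirchSwinnertonDyer.BirchSwinnertonDyer.Theses.UniversalToricDescent
import Summits.BirchSwinnertonDyer.BirchSwinnertonDyer.Theorems.UniversalToricDescentThinCombRigidity
import HarnessLib

/-!
# DOORS for crux idea `thin-comb-reflection` on the WALL `AdditiveSplitIMCInclusionAtThree`
# (stmt-BirchSwinnertonDyer-20395) — lead cruxlead-20395 g2, 2026-08-29 (crux workfile `Lines/thin_comb_doors.lean`;
# NOT a registered skeleton: the package door below is SOFT — see HONESTY)

What this file establishes, kernel-checked, BY NAME against the route decl:

* `IntCombPackageAt chAc L` / `RatCombPackageAt chAc L` — the INTEGRAL / RATIONAL thin-comb package at one frame, in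
  the 𝒪-rational comb currency of `Theorems/UniversalToricDescentThinCombDefs.lean` (`R₀ = unrIntegers 3`,
  `Λ₂(R₀) = R₀⟦T₂⟧⟦T₁⟧`): a reflection `ρ` (`IsReflection`), `G, L₂ ∈ Λ₂(R₀)` with `ρ G ∼ G` (K4, algebraic FE),
  `ρ L₂ ∼ L₂` (K3(iii), analytic FE), `ThinCombDvdInt/Rat R₀ 3 G L₂` (K2⁺ / K2, the comb supply), a restriction
  `πac : Λ₂(R₀) →+* R₀⟦T⟧` with `πac G ∈ chAc` (S2, control, integral) resp. `3^k·πac G ∈ chAc`, and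
  `πac L₂ ∼ L` (K3(ii), comparison with the BDP frame).
* `IntegralThinCombPackage` / `RationalThinCombPackage` — the package at EVERY frame of the crux (crux binders
  verbatim).
* `additiveSplitIMCInclusionAtThree_of_rigidity_of_package : CombReflectionRigidityInt R₀ 3 → IntegralThinCombPackage →
  AdditiveSplitIMCInclusionAtThree` and, with K1 DISCHARGED by the tree theorem
  `…Theorems.UniversalToricDescentThinComb.combReflectionRigidityInt_unrIntegers` (p690436),
  **`additiveSplitIMCInclusionAtThree_of_package : IntegralThinCombPackage → AdditiveSplitIMCInclusionAtThree`** —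
  the wall BY NAME from the integral package alone.
* `ratWall_of_package : RationalThinCombPackage → RatWallAtThree` (the RATIONAL wall `∃ k, (3^k·L) ⊆ Ch·R₀⟦T⟧`, the
  honest output of the rational comb; it feeds the PARENT 20186 via twin-μ 20400, memo v32 / card Transfer).

HONESTY. (1) The package doors quantify `ρ, G, L₂, πac` EXISTENTIALLY: `G` is NOT pinned to a generator of
`ch_{Λ₂}(X_{∅,0}(E/K̃_∞))·R₀` (tree `WeierstrassCurve.XGr₂ … (vbar := 𝔭')`, `XGr₂.charIdeal`) and `πac` is NOT pinned to
the restriction attached to `κ` (tree `XGr₂.toXAc`, which lives in (cyc, ac)-adapted coordinates `T₁ ↦ 0`, whereas the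
comb of the Defs file is vertical in (γ_𝔭, γ_𝔭')-coordinates — an explicit change-of-coordinates automorphism of
`Λ₂(R₀)` belongs in the pinned package). A REGISTRABLE line must pin both (else the ∃-package is critic-bait); that
typing is crux-plan work and is REQUESTED from the pen (PICKED.md g2). (2) Nothing here is evidence that the
package EXISTS at an additive split 3: K2⁺ (integral BF comb supply + θ-dominant ERL at a supercuspidal prime +
Λ-adic Kolyvagin bound at p = 3), K3 (two-variable toric `L₂` at `3 ∣ N` with unit-multiplier FE), K4 (two-variable
algebraic FE at additive 3) are beyond print (card). (3) What IS settled: the algebra K1 (both forms) is a theorem of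
the tree; the by-name plumbing from the package to the route decl is the 6-line proof below.
BSD is not proved by any of this; 20395 OPEN.
-/

set_option linter.dupNamespace false
set_option linter.unusedVariables false

noncomputable section

namespace Summit.BirchSwinnertonDyer.BirchSwinnertonDyer.Cruxes.AdditiveSplitIMCInclusionAtThree.ThinCombDoors

open Summit.BirchSwinnertonDyer.BirchSwinnertonDyer.Theorems.UniversalToricDescentThinComb
open Literature.NumberTheory.EllipticCurves

/-- The INTEGRAL thin-comb package at one frame `L` against the ideal `chAc ⊆ R₀⟦T⟧` (SOFT: `G`, `πac` unpinned). -/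
def IntCombPackageAt (chAc : Ideal (UnrSeries 3)) (L : UnrSeries 3) : Prop :=
  ∃ (ρ : PowerSeries (PowerSeries (unrIntegers 3)) ≃+* PowerSeries (PowerSeries (unrIntegers 3)))
    (G L₂ : PowerSeries (PowerSeries (unrIntegers 3)))
    (πac : PowerSeries (PowerSeries (unrIntegers 3)) →+* UnrSeries 3),
    IsReflection (unrIntegers 3) ρ ∧ Associated (ρ G) G ∧ Associated (ρ L₂) L₂ ∧
    ThinCombDvdInt (unrIntegers 3) 3 G L₂ ∧ πac G ∈ chAc ∧ Associated (πac L₂) L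

/-- The RATIONAL thin-comb package at one frame (slack `3^t` on the comb, `3^k` in the control). -/
def RatCombPackageAt (chAc : Ideal (UnrSeries 3)) (L : UnrSeries 3) : Prop :=
  ∃ (ρ : PowerSeries (PowerSeries (unrIntegers 3)) ≃+* PowerSeries (PowerSeries (unrIntegers 3)))
    (G L₂ : PowerSeries (PowerSeries (unrIntegers 3)))
    (πac : PowerSeries (PowerSeries (unrIntegers 3)) →+* UnrSeries 3),
    IsReflection (unrIntegers 3) ρ ∧ Associated (ρ G) G ∧ Associated (ρ L₂) L₂ ∧
    ThinCombDvdRat (unrIntegers 3) 3 G L₂ ∧ (∃ k : ℕ, ((3 : ℕ) : UnrSeries 3) ^ k * πac G ∈ chAc) ∧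
    Associated (πac L₂) L

/-- DOOR (integral): the package at every frame of the crux (binders of `AdditiveSplitIMCInclusionAtThree` verbatim). -/
def IntegralThinCombPackage : Prop :=
  ∀ (W : WeierstrassCurve ℚ) [W.IsElliptic] [W.IsGloballyMinimal] (N : ℕ) [NeZero N] (K : Type) [Field K] [NumberField K] (Dt : Literature.NumberTheory.EllipticCurves.ModularForms.ModularParametrizationData W N), Summit.BirchSwinnertonDyer.Rank1Residual.Additive.ClassO6 W 3 → W.HasSurjectiveModNGaloisRep 3 → W.analyticRank = 1 → W.conductorNorm ℤ = N → Literature.NumberTheory.EllipticCurves.IsImaginaryQuadratic K → Literature.NumberTheory.EllipticCurves.SatisfiesHeegnerHypothesis N K → ∀ (κ : Literature.NumberTheory.EllipticCurves.ZpExtension K 3), κ.IsAnticyclotomic → ∀ (γ : Field.absoluteGaloisGroup K) [Fact (κ.IsTopGenerator γ)] (𝔭 : IsDedekindDomain.HeightOneSpectrum (NumberField.RingOfIntegers K)), ((3 : ℕ) : NumberField.RingOfIntegers K) ∈ 𝔭.asIdeal → 𝔭.asIdeal.ramificationIdx (NumberField.RingOfIntegers ℚ) = 1 → 𝔭.asIdeal.inertiaDeg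 (NumberField.RingOfIntegers ℚ) = 1 → ∀ (𝔭' : IsDedekindDomain.HeightOneSpectrum (NumberField.RingOfIntegers K)), ((3 : ℕ) : NumberField.RingOfIntegers K) ∈ 𝔭'.asIdeal → 𝔭' ≠ 𝔭 → ∀ (ι' : PadicAlgCl 3 ≃+* ℂ), Summit.BirchSwinnertonDyer.BirchSwinnertonDyer.Theorems.SchneiderFree.BranchInducesPrime 3 ι' 𝔭 → ∀ (ΩK : ℂ) (Ωp : ℂ_[3]) (L : Literature.NumberTheory.EllipticCurves.UnrSeries 3), ΩK ≠ 0 → Ωp ≠ 0 → Literature.NumberTheory.EllipticCurves.IsBDPLFunction ι' 𝔭 κ γ Dt.f ΩK Ωp L → IntCombPackageAt ((Summit.BirchSwinnertonDyer.Rank1Residual.X11b.AcSelmer.XAc.charIdeal (W.baseChange K) 3 κ 𝔭' ∅ γ).map (PowerSeries.map (Summit.BirchSwinnertonDyer.Rank1Residual.X11b.Halves.toUnr 3))) L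

/-- DOOR (rational): the rational package at every frame of the crux. -/
def RationalThinCombPackage : Prop :=
  ∀ (W : WeierstrassCurve ℚ) [W.IsElliptic] [W.IsGloballyMinimal] (N : ℕ) [NeZero N] (K : Type) [Field K] [NumberField K] (Dt : Literature.NumberTheory.EllipticCurves.ModularForms.ModularParametrizationData W N), Summit.BirchSwinnertonDyer.Rank1Residual.Additive.ClassO6 W 3 → W.HasSurjectiveModNGaloisRep 3 → W.analyticRank = 1 → W.conductorNorm ℤ = N → Literature.NumberTheory.EllipticCurves.IsImaginaryQuadratic K → Literature.NumberTheory.EllipticCurves.SatisfiesHeegnerHypothesis N K → ∀ (κ : Literature.NumberTheory.EllipticCurves.ZpExtension K 3), κ.IsAnticyclotomic → ∀ (γ : Field.absoluteGaloisGroup K) [Fact (κ.IsTopGenerator γ)] (𝔭 : IsDedekindDomain.HeightOneSpectrum (NumberField.RingOfIntegers K)), ((3 : ℕ) : NumberField.RingOfIntegers K) ∈ 𝔭.asIdeal → 𝔭.asIdeal.ramificationIdx (NumberField.RingOfIntegers ℚ) = 1 → 𝔭.asIdeal.inertiaDeg (NumberField.RingOfIntegers ℚ) = 1 → ∀ (𝔭'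 : IsDedekindDomain.HeightOneSpectrum (NumberField.RingOfIntegers K)), ((3 : ℕ) : NumberField.RingOfIntegers K) ∈ 𝔭'.asIdeal → 𝔭' ≠ 𝔭 → ∀ (ι' : PadicAlgCl 3 ≃+* ℂ), Summit.BirchSwinnertonDyer.BirchSwinnertonDyer.Theorems.SchneiderFree.BranchInducesPrime 3 ι' 𝔭 → ∀ (ΩK : ℂ) (Ωp : ℂ_[3]) (L : Literature.NumberTheory.EllipticCurves.UnrSeries 3), ΩK ≠ 0 → Ωp ≠ 0 → Literature.NumberTheory.EllipticCurves.IsBDPLFunction ι' 𝔭 κ γ Dt.f ΩK Ωp L → RatCombPackageAt ((Summit.BirchSwinnertonDyer.Rank1Residual.X11b.AcSelmer.XAc.charIdeal (W.baseChange K) 3 κ 𝔭' ∅ γ).map (PowerSeries.map (Summit.BirchSwinnertonDyer.Rank1Residual.X11b.Halves.toUnr 3))) L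

/-- The RATIONAL wall at 3 (memo v32 `RatWall`): `∃ k, (3^k · L) ⊆ Ch_Λ(X_{∅,0})·R₀⟦T⟧` at every frame. -/
def RatWallAtThree : Prop :=
  ∀ (W : WeierstrassCurve ℚ) [W.IsElliptic] [W.IsGloballyMinimal] (N : ℕ) [NeZero N] (K : Type) [Field K] [NumberField K] (Dt : Literature.NumberTheory.EllipticCurves.ModularForms.ModularParametrizationData W N), Summit.BirchSwinnertonDyer.Rank1Residual.Additive.ClassO6 W 3 → W.HasSurjectiveModNGaloisRep 3 → W.analyticRank = 1 → W.conductorNorm ℤ = N → Literature.NumberTheory.EllipticCurves.IsImaginaryQuadratic K → Literature.NumberTheory.EllipticCurves.SatisfiesHeegnerHypothesis N K → ∀ (κ : Literature.NumberTheory.EllipticCurves.ZpExtension K 3), κ.IsAnticyclotomic → ∀ (γ : Field.absoluteGaloisGroup K) [Fact (κ.IsTopGenerator γ)] (𝔭 : IsDedekindDomain.HeightOneSpectrum (NumberField.RingOfIntegers K)), ((3 : ℕ) : NumberField.RingOfIntegers K) ∈ 𝔭.asIdeal → 𝔭.asIdeal.ramificationIdx (NumberField.RingOfIntegers ℚ)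 = 1 → 𝔭.asIdeal.inertiaDeg (NumberField.RingOfIntegers ℚ) = 1 → ∀ (𝔭' : IsDedekindDomain.HeightOneSpectrum (NumberField.RingOfIntegers K)), ((3 : ℕ) : NumberField.RingOfIntegers K) ∈ 𝔭'.asIdeal → 𝔭' ≠ 𝔭 → ∀ (ι' : PadicAlgCl 3 ≃+* ℂ), Summit.BirchSwinnertonDyer.BirchSwinnertonDyer.Theorems.SchneiderFree.BranchInducesPrime 3 ι' 𝔭 → ∀ (ΩK : ℂ) (Ωp : ℂ_[3]) (L : Literature.NumberTheory.EllipticCurves.UnrSeries 3), ΩK ≠ 0 → Ωp ≠ 0 → Literature.NumberTheory.EllipticCurves.IsBDPLFunction ι' 𝔭 κ γ Dt.f ΩK Ωp L → ∃ k : ℕ, Ideal.span {((3 : ℕ) : Literature.NumberTheory.EllipticCurves.UnrSeries 3) ^ k * L} ≤ ((Summit.BirchSwinnertonDyer.Rank1Residual.X11b.AcSelmer.XAc.charIdeal (W.baseChange K) 3 κ 𝔭' ∅ γ).map (PowerSeries.map (Summit.BirchSwinnertonDyer.Rank1Residual.X11b.Halves.toUnr 3)))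

/-- One frame, integral: rigidity + package ⟹ `(L) ⊆ chAc`. -/
theorem span_le_of_intCombPackageAt (hrig : CombReflectionRigidityInt (unrIntegers 3) 3)
    {chAc : Ideal (UnrSeries 3)} {L : UnrSeries 3} (h : IntCombPackageAt chAc L) : Ideal.span {L} ≤ chAc := by
  obtain ⟨ρ, G, L₂, πac, hρ, hG, hL₂, hcomb, hctl, ⟨u, hu⟩⟩ := h
  obtain ⟨c, hc⟩ := hrig ρ hρ G L₂ hG hL₂ hcomb
  rw [Ideal.span_singleton_le_iff_mem, ← hu, hc, map_mul, mul_assoc]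
  exact chAc.mul_mem_right _ hctl

/-- One frame, rational: rigidity + package ⟹ `∃ k, (3^k·L) ⊆ chAc`. -/
theorem exists_span_le_of_ratCombPackageAt (hrig : CombReflectionRigidityRat (unrIntegers 3) 3)
    {chAc : Ideal (UnrSeries 3)} {L : UnrSeries 3} (h : RatCombPackageAt chAc L) :
    ∃ k : ℕ, Ideal.span {((3 : ℕ) : UnrSeries 3) ^ k * L} ≤ chAc := by
  obtain ⟨ρ, G, L₂, πac, hρ, hG, hL₂, hcomb, ⟨k, hctl⟩, ⟨u, hu⟩⟩ := h
  obtain ⟨a, c, hc⟩ := hrig ρ hρ G L₂ hG hL₂ hcomb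
  refine ⟨k + a, ?_⟩
  have h1 : ((3 : ℕ) : UnrSeries 3) ^ a * πac L₂ = πac G * πac c := by
    have := congrArg πac hc
    rwa [map_mul, map_mul, map_pow, map_natCast, map_pow, map_natCast] at this
  rw [Ideal.span_singleton_le_iff_mem, ← hu]
  have h2 : ((3 : ℕ) : UnrSeries 3) ^ (k + a) * (πac L₂ * ↑u) =
      (((3 : ℕ) : UnrSeries 3) ^ k * πac G) * (πac c * ↑u) := by
    rw [pow_add, mul_assoc, ← mul_assoc (((3 : ℕ) : UnrSeries 3) ^ a), h1]; ring
  rw [h2]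
  exact chAc.mul_mem_right _ hctl

/-- **The RATIONAL wall from the rational package** (K1 rational form discharged by the tree theorem
`combReflectionRigidityRat_unrIntegers`). -/
theorem ratWall_of_package (hpkg : RationalThinCombPackage) : RatWallAtThree := by
  intro W _ _ N _ K _ _ Dt hO6 hsurj hr1 hN hK hH κ hκ γ _ 𝔭 h3 he hf 𝔭' h3' hne ι' hι ΩK Ωp L hΩK hΩp hL
  exact exists_span_le_of_ratCombPackageAt (combReflectionRigidityRat_unrIntegers 3)
    (hpkg W N K Dt hO6 hsurj hr1 hN hK hH κ hκ γ 𝔭 h3 he hf 𝔭' h3' hne ι' hι ΩK Ωp L hΩK hΩp hL)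

/-- **The wall BY NAME from rigidity + the integral package.** -/
theorem additiveSplitIMCInclusionAtThree_of_rigidity_of_package (hrig : CombReflectionRigidityInt (unrIntegers 3) 3)
    (hpkg : IntegralThinCombPackage) :
    Summit.BirchSwinnertonDyer.BirchSwinnertonDyer.Theses.UniversalToricDescent.AdditiveSplitIMCInclusionAtThree := by
  intro W _ _ N _ K _ _ Dt hO6 hsurj hr1 hN hK hH κ hκ γ _ 𝔭 h3 he hf 𝔭' h3' hne ι' hι ΩK Ωp L hΩK hΩp hL
  exact span_le_of_intCombPackageAt hrig
    (hpkg W N K Dt hO6 hsurj hr1 hN hK hH κ hκ γ 𝔭 h3 he hf 𝔭' h3' hne ι' hι ΩK Ωp L hΩK hΩp hL)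

/-- **The wall BY NAME from the integral package alone** (K1 discharged by the tree theorem
`combReflectionRigidityInt_unrIntegers`). -/
theorem additiveSplitIMCInclusionAtThree_of_package (hpkg : IntegralThinCombPackage) :
    Summit.BirchSwinnertonDyer.BirchSwinnertonDyer.Theses.UniversalToricDescent.AdditiveSplitIMCInclusionAtThree :=
  additiveSplitIMCInclusionAtThree_of_rigidity_of_package (combReflectionRigidityInt_unrIntegers 3) hpkg

end Summit.BirchSwinnertonDyer.BirchSwinnertonDyer.Cruxes.AdditiveSplitIMCInclusionAtThree.ThinCombDoors

end
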